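import Literature.RepresentationTheory.KonnoKonno2007.JunctionContinuityKAK
import Literature.Analysis.SegalBargmann.SchwartzDegreeOneKTypes
import HarnessLib

/-!
# The `K × K′`-type of the degree-one vectors of an archimedean Weil datum on the junction `U(P,Q) × U(R,S)` (Folland 1989, Prop. (4.39); Kashiwara–Vergne 1978; Konno–Konno 2007, Lemma 5.2)

Topic `RepresentationTheory/KonnoKonno2007`; namespace `Literature.RepresentationTheory.KonnoKonno2007.RealDualPair`.
For the real unitary dual pair junction of `RealUnitaryDualPair` (`Ginf P Q R S = U(P,Q) × U(R,S)`, `ι𝕎`, compact part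
`κ : (U(P)×U(Q))×(U(R)×U(S)) →* Ginf`, `ι𝕎_κ : ι𝕎 (κ k) = realifySp (dualPairι k)`) and ANY family
`ω : Representation ℂ Ginf 𝓢(ℝ^{DPIdx P Q R S})` carrying the two ALGEBRAIC clauses of an `IsArchWeilDatum` — (w2)
Heisenberg covariance along `ι𝕎`, (w2′) unitary lifts — and the printed VACUUM VALUES `ω (κ k) h₀ = vacScalar e k • h₀`
(Konno–Konno Lemma 5.2: the Gaussian is a `K × K′`-eigenvector with a determinant-power character):

* `isRhoCovariantS_comp_κ`: `k ↦ ω (κ k)` is covariant through the block datum `dualPairι` (bridge `ι𝕎_κ`);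
* `apply_κ_eq_vacScalar_smul_unitaryOpPi`: **`ω (κ k) f = vacScalar e k • μ₀(dualPairι k) f` for every Schwartz `f`** —
  the whole `K × K′`-action of the datum is Folland's `μ₀` twisted by the vacuum character (rigidity
  `IsRhoCovariantS.apply_eq_vacCoeff_smul_unitaryOpPi` + the vacuum calibration `apply_hermitePi_zero`);
* `apply_κ_degOnePR`: on the holomorphic degree-`(1,0)` family `degOnePR : (P × R → ℂ) →ₗ 𝓢` of
  `SchwartzDegreeOneKTypes`, `ω (κ ((A,B),(C,D))) (degOnePR a) = vacScalar e k • degOnePR ((A ⊗ₖ C) a)` — `K × K′`-type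
  `χ_e ⊗ (std_P ⊠ std_R)`; the four blocks at once (`apply_κ_degOne`);
* rank-one second member `R = Unit` (`degOneP : (P → ℂ) →ₗ 𝓢`): `apply_κ_degOneP :
  ω (κ ((A,B),(C,D))) (degOneP a) = (vacScalar e k * C) • degOneP (A a)` and its `K = U(P)×U(Q)`-part
  `apply_κ_degOneP_fst : ω (κ ((A,B),1)) (degOneP a) = (det A ^ e_P * det B ^ e_Q) • degOneP (A a)` — the degree-one
  harmonic family is `K`-EQUIVARIANT OF TYPE `det^{e_P} ⊗ std` on `U(P)` and `det^{e_Q}` on `U(Q)`;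
* the cell's pair `U(2,1) × U(1)` (currency `DPIdx (Fin 2) Unit Unit Empty`): `apply_κ_degOneP_ι₁`, `apply_κ_degOneP_fst_ι₁`.

Pure consequences of landed tree theorems; the only hypotheses are the algebraic clauses (w2), (w2′) and the vacuum
values, each consumed in the proofs; no cited statement is used as a hypothesis.

## References

* [Folland1989] G. B. Folland, *Harmonic Analysis in Phase Space*, Princeton UP (1989), §4.2 (Schur remark p. 156),
  Prop. (4.39). [cite: Folland1989, Prop (4.39)]
* M. Kashiwara, M. Vergne, *On the Segal–Shale–Weil representations and harmonic polynomials*, Invent. Math. 44 (1978)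
  1–47, (5.1)–(5.5), Thm (6.3)/(7.2) (the `K×K′`-types of the Fock model of `(U(p,q), U(r,s))`).
* [KonnoKonno2007] T. Konno, K. Konno, Kobe J. Math. 24 (2007), §3.1, §3.3, Lemma 5.2 (the vacuum character).

## Provenance

LEAN-IN-TREE rule (2026-08-18), pub-hodgecm model-construction sub-cell, seat mc-theta-2 gen 4: tree half of the
archimedean `K`-type clause (W-K∞′) `ArchKTypeData.harm` (`ωinf (κ₁ u) (Φarch ℓ) = Φarch (τ₁^∨ u ℓ)`); the model half
(identifying the stabiliser of the base point with `U(2) × U(1)`, the cotangent weight with `det^{e} ⊗ std`, and the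
exponents `e`) is the consumer's.
-/

set_option autoImplicit false

noncomputable section

open MeasureTheory Complex SchwartzMap Matrix
open scoped InnerProductSpace ComplexConjugate Real Kronecker Matrix

namespace Literature.RepresentationTheory.KonnoKonno2007

namespace RealDualPair

open Literature.Analysis.SegalBargmann Literature.RepresentationTheory.HeisenbergGroup
open Literature.NumberTheory.Weil1964 Literature.NumberTheory.Automorphic
open Literature.NumberTheory.Automorphic.UnitaryGroup

local notation "SR" σ => SchwartzMap (σ → ℝ) ℂ
local notation "PV" σ => (σ → ℝ) × (σ → ℝ)

/-- Notation (NOT a definition): `HasUnitaryLift[σ] A` abbreviates the (w2′) clause shape of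
`IsArchWeilDatum.exists_lift`. -/
local notation "HasUnitaryLift[" σ "]" A:max =>
  ∃ U : Lp ℂ 2 (volume : Measure (σ → ℝ)) ≃ₗᵢ[ℂ] Lp ℂ 2 (volume : Measure (σ → ℝ)),
    LiftsTo A ((LinearIsometryEquiv.toContinuousLinearEquiv U :
        Lp ℂ 2 (volume : Measure (σ → ℝ)) ≃L[ℂ] Lp ℂ 2 (volume : Measure (σ → ℝ))) :
      Lp ℂ 2 (volume : Measure (σ → ℝ)) →L[ℂ] Lp ℂ 2 (volume : Measure (σ → ℝ)))

section General

variable {P Q R S : Type*} [Fintype P] [DecidableEq P] [Fintype Q] [DecidableEq Q] [Fintype R] [DecidableEq R]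
  [Fintype S] [DecidableEq S]

/-- **(w2) along `κ` is covariance through the block datum**: `k ↦ ω (κ k)` is `IsRhoCovariantS dualPairι` (bridge
`ι𝕎_κ : ι𝕎 (κ k) = realifySp (dualPairι k)`). [cite: Folland1989, §4.2, (4.23)] -/
theorem isRhoCovariantS_comp_κ (ω : Representation ℂ (Ginf P Q R S) (SR (DPIdx P Q R S)))
    (hcov : IsPhaseCovariantS (fun g => ⇑((ι𝕎 P Q R S g).1 : (PV (DPIdx P Q R S)) ≃ₗ[ℝ] PV (DPIdx P Q R S)))
      (fun g => ω g)) :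
    IsRhoCovariantS (fun k : DPK P Q R S => dualPairι k) (fun k => ω (κ P Q R S k)) := by
  intro k p q f
  have h1 := hcov (κ P Q R S k) p q f
  have hreal : ∀ pq, ((ι𝕎 P Q R S (κ P Q R S k)).1 : (PV (DPIdx P Q R S)) ≃ₗ[ℝ] PV (DPIdx P Q R S)) pq =
      realify (dualPairι k) pq := fun pq => by rw [ι𝕎_κ]; rfl
  beta_reduce at h1 ⊢
  rw [hreal (p, q)] at h1
  exact h1

/-- **The `K × K′`-action of an archimedean Weil datum is `μ₀` twisted by the vacuum character**: from (w2), (w2′) and the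
vacuum values `ω (κ k) h₀ = vacScalar e k • h₀`, `ω (κ k) f = vacScalar e k • μ₀(dualPairι k) f` for EVERY Schwartz `f`.
[cite: Folland1989, §4.2, the Schur remark p. 156; Prop. (4.39)] -/
theorem apply_κ_eq_vacScalar_smul_unitaryOpPi (ω : Representation ℂ (Ginf P Q R S) (SR (DPIdx P Q R S)))
    (hcov : IsPhaseCovariantS (fun g => ⇑((ι𝕎 P Q R S g).1 : (PV (DPIdx P Q R S)) ≃ₗ[ℝ] PV (DPIdx P Q R S)))
      (fun g => ω g))
    (hlift : ∀ g, HasUnitaryLift[DPIdx P Q R S] (ω g)) {e : VacExponents}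
    (hvac : ∀ k : DPK P Q R S, ω (κ P Q R S k) (hermitePi 0) = vacScalar e k • hermitePi 0)
    (k : DPK P Q R S) (f : SR (DPIdx P Q R S)) :
    ω (κ P Q R S k) f = vacScalar e k • unitaryOpPi (dualPairι k) f := by
  have hS := isRhoCovariantS_comp_κ ω hcov
  obtain ⟨U, hU⟩ := exists_liftFamily (A := fun k => (ω (κ P Q R S k) : (SR (DPIdx P Q R S)) →ₗ[ℂ] SR (DPIdx P Q R S)))
    fun k => hlift (κ P Q R S k)
  have h0 := hS.apply_hermitePi_zero hU k
  beta_reduce at h0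
  rw [hvac k] at h0
  have hc : vacScalar e k = vacCoeff U k := smul_left_injective ℂ hermitePi_zero_ne_zero h0
  have h1 := hS.apply_eq_vacCoeff_smul_unitaryOpPi hU k f
  beta_reduce at h1
  rw [← hc] at h1
  exact h1

/-- **`K × K′` on the degree-one vectors, all four blocks**: `ω (κ ((A,B),(C,D))) (degOne (a ⊕ b ⊕ c ⊕ d)) =
vacScalar e k • degOne ((A⊗C) a ⊕ (B⊗D) b ⊕ conj(A⊗D) c ⊕ conj(B⊗C) d)`. [cite: Folland1989, Prop (4.39)] -/
theorem apply_κ_degOne (ω : Representation ℂ (Ginf P Q R S) (SR (DPIdx P Q R S)))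
    (hcov : IsPhaseCovariantS (fun g => ⇑((ι𝕎 P Q R S g).1 : (PV (DPIdx P Q R S)) ≃ₗ[ℝ] PV (DPIdx P Q R S)))
      (fun g => ω g))
    (hlift : ∀ g, HasUnitaryLift[DPIdx P Q R S] (ω g)) {e : VacExponents}
    (hvac : ∀ k : DPK P Q R S, ω (κ P Q R S k) (hermitePi 0) = vacScalar e k • hermitePi 0)
    (k : DPK P Q R S) (a : P × R → ℂ) (b : Q × S → ℂ) (c : P × S → ℂ) (d : Q × R → ℂ) :
    ω (κ P Q R S k) (degOne (Sum.elim (Sum.elim a b) (Sum.elim c d))) =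
      vacScalar e k • degOne (Sum.elim
        (Sum.elim (((k.1.1 : Matrix P P ℂ) ⊗ₖ (k.2.1 : Matrix R R ℂ)) *ᵥ a)
          (((k.1.2 : Matrix Q Q ℂ) ⊗ₖ (k.2.2 : Matrix S S ℂ)) *ᵥ b))
        (Sum.elim ((((k.1.1 : Matrix P P ℂ) ⊗ₖ (k.2.2 : Matrix S S ℂ)).map star) *ᵥ c)
          ((((k.1.2 : Matrix Q Q ℂ) ⊗ₖ (k.2.1 : Matrix R R ℂ)).map star) *ᵥ d))) := by
  rw [apply_κ_eq_vacScalar_smul_unitaryOpPi ω hcov hlift hvac, unitaryOpPi_dualPairι_degOne]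

/-- **`K × K′` on the holomorphic degree-`(1,0)` family**: `ω (κ ((A,B),(C,D))) (degOnePR a) =
vacScalar e k • degOnePR ((A ⊗ₖ C) a)` — type `χ_e ⊗ (std_P ⊠ std_R)`. [cite: Folland1989, Prop (4.39)] -/
theorem apply_κ_degOnePR (ω : Representation ℂ (Ginf P Q R S) (SR (DPIdx P Q R S)))
    (hcov : IsPhaseCovariantS (fun g => ⇑((ι𝕎 P Q R S g).1 : (PV (DPIdx P Q R S)) ≃ₗ[ℝ] PV (DPIdx P Q R S)))
      (fun g => ω g))
    (hlift : ∀ g, HasUnitaryLift[DPIdx P Q R S] (ω g)) {e : VacExponents}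
    (hvac : ∀ k : DPK P Q R S, ω (κ P Q R S k) (hermitePi 0) = vacScalar e k • hermitePi 0)
    (k : DPK P Q R S) (a : P × R → ℂ) :
    ω (κ P Q R S k) (degOnePR a) =
      vacScalar e k • degOnePR (((k.1.1 : Matrix P P ℂ) ⊗ₖ (k.2.1 : Matrix R R ℂ)) *ᵥ a) := by
  rw [apply_κ_eq_vacScalar_smul_unitaryOpPi ω hcov hlift hvac, unitaryOpPi_dualPairι_degOnePR]

end General

/-! ## Rank-one second member `R = Unit`: the family `degOneP : (P → ℂ) →ₗ 𝓢` -/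

section RankOne

variable {P Q S : Type*} [Fintype P] [DecidableEq P] [Fintype Q] [DecidableEq Q] [Fintype S] [DecidableEq S]

/-- **`K × K′` on `degOneP`** (`R = Unit`): `ω (κ ((A,B),(C,D))) (degOneP a) = (vacScalar e k * C) • degOneP (A a)`.
[cite: Folland1989, Prop (4.39)] -/
theorem apply_κ_degOneP (ω : Representation ℂ (Ginf P Q Unit S) (SR (DPIdx P Q Unit S)))
    (hcov : IsPhaseCovariantS
      (fun g => ⇑((ι𝕎 P Q Unit S g).1 : (PV (DPIdx P Q Unit S)) ≃ₗ[ℝ] PV (DPIdx P Q Unit S))) (fun g => ω g))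
    (hlift : ∀ g, HasUnitaryLift[DPIdx P Q Unit S] (ω g)) {e : VacExponents}
    (hvac : ∀ k : DPK P Q Unit S, ω (κ P Q Unit S k) (hermitePi 0) = vacScalar e k • hermitePi 0)
    (k : DPK P Q Unit S) (a : P → ℂ) :
    ω (κ P Q Unit S k) (degOneP a) =
      (vacScalar e k * (k.2.1 : Matrix Unit Unit ℂ) () ()) • degOneP ((k.1.1 : Matrix P P ℂ) *ᵥ a) := by
  rw [apply_κ_eq_vacScalar_smul_unitaryOpPi ω hcov hlift hvac, unitaryOpPi_dualPairι_degOneP, map_smul, smul_smul]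

/-- **The `K = U(P) × U(Q)`-type of the degree-one harmonic family** (`K′`-component trivial):
`ω (κ ((A,B),1)) (degOneP a) = (det A ^ e_P * det B ^ e_Q) • degOneP (A a)` — EQUIVARIANT OF TYPE `det^{e_P} ⊗ std` on
`U(P)` and `det^{e_Q}` on `U(Q)`. [cite: Folland1989, Prop (4.39)] -/
theorem apply_κ_degOneP_fst (ω : Representation ℂ (Ginf P Q Unit S) (SR (DPIdx P Q Unit S)))
    (hcov : IsPhaseCovariantS
      (fun g => ⇑((ι𝕎 P Q Unit S g).1 : (PV (DPIdx P Q Unit S)) ≃ₗ[ℝ] PV (DPIdx P Q Unit S))) (fun g => ω g))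
    (hlift : ∀ g, HasUnitaryLift[DPIdx P Q Unit S] (ω g)) {e : VacExponents}
    (hvac : ∀ k : DPK P Q Unit S, ω (κ P Q Unit S k) (hermitePi 0) = vacScalar e k • hermitePi 0)
    (kV : Matrix.unitaryGroup P ℂ × Matrix.unitaryGroup Q ℂ) (a : P → ℂ) :
    ω (κ P Q Unit S (kV, 1)) (degOneP a) =
      ((kV.1 : Matrix P P ℂ).det ^ e.eP * (kV.2 : Matrix Q Q ℂ).det ^ e.eQ) • degOneP ((kV.1 : Matrix P P ℂ) *ᵥ a) := by
  rw [apply_κ_eq_vacScalar_smul_unitaryOpPi ω hcov hlift hvac, unitaryOpPi_dualPairι_degOneP_fst]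
  congr 1
  simp [vacScalar]

end RankOne

/-! ## The cell's pair `U(2,1) × U(1)` -/

section IotaOne

/-- **`U(2,1) × U(1)`**: on the degree-one harmonic family `degOneP : (Fin 2 → ℂ) →ₗ 𝓢(ℝ³)` the compact group
`(U(2) × U(1)) × (U(1) × U(∅))` acts by `(vacScalar e k * C) • degOneP (A a)`. [cite: Folland1989, Prop (4.39)] -/
theorem apply_κ_degOneP_ι₁ (ω : Representation ℂ (Ginf (Fin 2) Unit Unit Empty) (SR (DPIdx (Fin 2) Unit Unit Empty)))
    (hcov : IsPhaseCovariantS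
      (fun g => ⇑((ι𝕎 (Fin 2) Unit Unit Empty g).1 :
        (PV (DPIdx (Fin 2) Unit Unit Empty)) ≃ₗ[ℝ] PV (DPIdx (Fin 2) Unit Unit Empty))) (fun g => ω g))
    (hlift : ∀ g, HasUnitaryLift[DPIdx (Fin 2) Unit Unit Empty] (ω g)) {e : VacExponents}
    (hvac : ∀ k : DPK (Fin 2) Unit Unit Empty,
      ω (κ (Fin 2) Unit Unit Empty k) (hermitePi 0) = vacScalar e k • hermitePi 0)
    (k : DPK (Fin 2) Unit Unit Empty) (a : Fin 2 → ℂ) :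
    ω (κ (Fin 2) Unit Unit Empty k) (degOneP a) =
      (vacScalar e k * (k.2.1 : Matrix Unit Unit ℂ) () ()) • degOneP ((k.1.1 : Matrix (Fin 2) (Fin 2) ℂ) *ᵥ a) :=
  apply_κ_degOneP ω hcov hlift hvac k a

/-- **`U(2,1) × U(1)`, the `K_∞ = U(2) × U(1)`-type**: `ω (κ ((A,B),1)) (degOneP a) = (det A ^ e_P * det B ^ e_Q) •
degOneP (A a)` — the (W-K∞′) shape: the degree-one harmonic family is `K_∞`-equivariant of type `det^{e_P} ⊗ std ⊠ det^{e_Q}`.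
[cite: Folland1989, Prop (4.39)] -/
theorem apply_κ_degOneP_fst_ι₁
    (ω : Representation ℂ (Ginf (Fin 2) Unit Unit Empty) (SR (DPIdx (Fin 2) Unit Unit Empty)))
    (hcov : IsPhaseCovariantS
      (fun g => ⇑((ι𝕎 (Fin 2) Unit Unit Empty g).1 :
        (PV (DPIdx (Fin 2) Unit Unit Empty)) ≃ₗ[ℝ] PV (DPIdx (Fin 2) Unit Unit Empty))) (fun g => ω g))
    (hlift : ∀ g, HasUnitaryLift[DPIdx (Fin 2) Unit Unit Empty] (ω g)) {e : VacExponents}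
    (hvac : ∀ k : DPK (Fin 2) Unit Unit Empty,
      ω (κ (Fin 2) Unit Unit Empty k) (hermitePi 0) = vacScalar e k • hermitePi 0)
    (kV : Matrix.unitaryGroup (Fin 2) ℂ × Matrix.unitaryGroup Unit ℂ) (a : Fin 2 → ℂ) :
    ω (κ (Fin 2) Unit Unit Empty (kV, 1)) (degOneP a) =
      ((kV.1 : Matrix (Fin 2) (Fin 2) ℂ).det ^ e.eP * (kV.2 : Matrix Unit Unit ℂ).det ^ e.eQ) •
        degOneP ((kV.1 : Matrix (Fin 2) (Fin 2) ℂ) *ᵥ a) :=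
  apply_κ_degOneP_fst ω hcov hlift hvac kV a

end IotaOne

end RealDualPair

end Literature.RepresentationTheory.KonnoKonno2007
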